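import Mathlib
import Summits.NavierStokesRegularity.NavierStokesRegularity.Theorems.FrozenSignCascadeTightEnvelopeContinuationRadial
import HarnessLib

/-!
# Route FrozenSignCascade · crux `EnvelopeBound` (stmt-NavierStokesRegularity-1549): the
  small-data regime, I — the critical kernel bound

Support file for the crux item stmt-NavierStokesRegularity-1549 (`EnvelopeBound`); lands
`--supports` that item (line `registered`; helper `envelopeBound_smallDataKernel` of the support
sub-goal `envelopeBound_smallData`, whose bootstrap is in the companion file
`FrozenSignCascadeEnvelopeBoundSmallData`).

**Theorem (`envelopeBound_smallDataKernel`).** If a coefficient field `v : ℝ³ → ℂ³` lies under a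
critical (`PM²`) envelope, `‖η‖² ‖v(η)‖ ≤ M` for all `η`, then the Fourier-side Navier–Stokes
nonlinearity obeys `‖N(v,v)(ξ)‖ ≤ 864π · 3|B₁| · M²` at every frequency `ξ` — the scale-invariant
bilinear estimate of the Le Jan–Sznitman small-data theory (Le Jan–Sznitman 1997; Cannone–Karch
2004; Lemarié-Rieusset 2016, §8.5 / Thm. 8.19), in the elementary form needed for an a-priori
bootstrap.

Proof.
* `integral_ball_inv_norm_sq_le`, `integral_tail_inv_norm_four_le` (with integrability): the ball
  integral `∫_{‖ζ‖<ρ} ‖ζ‖⁻² dζ ≤ 3|B₁| ρ` and the tail integral `∫_{‖η‖≥r₀} ‖η‖⁻⁴ dη ≤ 3|B₁|/r₀` by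
  polar coordinates (`TightEnvelope.integral_fun_norm_three`, `integrableOn_fun_norm_addHaar`,
  `integrable_fun_norm_addHaar`).
* `norm_fconv_le_of_envelope`: the convolution obeys the scale-critical bound
  `‖(v_j ⋆ v_k)(ξ)‖ ≤ 24 M² · 3|B₁| · ‖ξ‖⁻¹` (`ξ ≠ 0`) — the kernel estimate
  `∫ ‖η‖⁻² ‖ξ-η‖⁻² dη ≲ ‖ξ‖⁻¹`, by symmetrisation over `‖ξ‖ ≤ 2‖η‖ ∨ ‖ξ‖ ≤ 2‖ξ-η‖`
  (`TightEnvelope.norm_le_two_mul_or`): on `‖ξ‖ ≤ 2‖η‖` the factor at `η` carries `4M‖ξ‖⁻²`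
  against the ball integral in `ζ = ξ - η`, `‖ζ‖ < ‖ξ‖`, while for `‖ζ‖ ≥ ‖ξ‖` one has `‖η‖ ≤ 2‖ζ‖`
  and the product is `≤ 4M²‖η‖⁻⁴` on the tail `‖η‖ ≥ ‖ξ‖/2`; the pointwise bounds hold off the
  null set `{0, ξ}`.
* the symbol bound `TightEnvelope.norm_nonlin_le_of_fconv_le` (`36π‖ξ‖ X`) and `N(v,v)(0) = 0`.

References: Y. Le Jan, A.-S. Sznitman, PTRF 109 (1997); M. Cannone, G. Karch, J. Differential
Equations 197 (2004); P. G. Lemarié-Rieusset, *The Navier–Stokes problem in the 21st century*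
(2016), §8.5.
-/

noncomputable section

set_option linter.dupNamespace false -- nested layout Summit.<S>.<Sub>, Sub = S (D-0017)

open MeasureTheory Set Metric Real Filter Topology
open Literature.Analysis.FluidPDE.FourierNS
open Summit.NavierStokesRegularity.NavierStokesRegularity.Theorems.TightEnvelope

namespace Summit.NavierStokesRegularity.NavierStokesRegularity.Theorems.EnvelopeBound.Registered

/-! ### Two radial integrals on `ℝ³` -/

/-- `‖ζ‖⁻²` is integrable on every ball of `ℝ³` about the origin (polar coordinates,
`integrableOn_fun_norm_addHaar`: the radial integrand `y² · y⁻² = 1` is integrable on `(0, ρ)`). -/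
theorem integrableOn_inv_norm_sq_ball (ρ : ℝ) :
    IntegrableOn (fun ζ : EuclideanSpace ℝ (Fin 3) => (‖ζ‖ ^ 2)⁻¹)
      (ball (0 : EuclideanSpace ℝ (Fin 3)) ρ) volume := by
  have h := integrableOn_fun_norm_addHaar (volume : Measure (EuclideanSpace ℝ (Fin 3)))
    (f := fun y : ℝ => (y ^ 2)⁻¹) (r := ρ)
  rw [finrank_euclideanSpace_fin_three] at h
  refine h.2 ?_
  have heq : EqOn (fun y : ℝ => y ^ (3 - 1) • (y ^ 2)⁻¹) (fun _ => (1 : ℝ)) (Ioo 0 ρ) := by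
    intro y hy
    have hy0 : y ≠ 0 := ne_of_gt hy.1
    show y ^ (3 - 1) • (y ^ 2)⁻¹ = 1
    rw [show (3 : ℕ) - 1 = 2 from rfl, smul_eq_mul, mul_inv_cancel₀ (pow_ne_zero 2 hy0)]
  rw [integrableOn_congr_fun heq measurableSet_Ioo]
  exact integrableOn_const (by rw [Real.volume_Ioo]; exact ENNReal.ofReal_ne_top)

/-- **The ball integral of `‖ζ‖⁻²`**: `∫ 1_{‖ζ‖ < ρ} ‖ζ‖⁻² dζ ≤ 3|B₁| ρ` for `0 ≤ ρ` (polar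
coordinates: the radial integrand is `1_{(0,ρ)}`; in fact equality). -/
theorem integral_ball_inv_norm_sq_le {ρ : ℝ} (hρ : 0 ≤ ρ) :
    ∫ ζ : EuclideanSpace ℝ (Fin 3),
        (ball (0 : EuclideanSpace ℝ (Fin 3)) ρ).indicator (fun ζ => (‖ζ‖ ^ 2)⁻¹) ζ ≤
      3 * (volume (ball (0 : EuclideanSpace ℝ (Fin 3)) 1)).toReal * ρ := by
  set f : ℝ → ℝ := (Iio ρ).indicator fun y => (y ^ 2)⁻¹ with hf
  have hfun : (fun ζ : EuclideanSpace ℝ (Fin 3) =>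
      (ball (0 : EuclideanSpace ℝ (Fin 3)) ρ).indicator (fun ζ => (‖ζ‖ ^ 2)⁻¹) ζ) =
      fun ζ => f ‖ζ‖ := by
    funext ζ
    simp only [hf, indicator, mem_ball_zero_iff, mem_Iio]
  rw [hfun, integral_fun_norm_three f]
  have hvol : 0 ≤ 3 * (volume (ball (0 : EuclideanSpace ℝ (Fin 3)) 1)).toReal := by positivity
  refine mul_le_mul_of_nonneg_left ?_ hvol
  have hpt : ∀ y ∈ Ioi (0 : ℝ), y ^ 2 * f y = (Iio ρ).indicator (fun _ => (1 : ℝ)) y := by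
    intro y hy
    simp only [hf, indicator, mem_Iio]
    split_ifs with h
    · have hy0 : y ≠ 0 := ne_of_gt hy
      field_simp
    · simp
  rw [setIntegral_congr_fun measurableSet_Ioi hpt, setIntegral_indicator measurableSet_Iio,
    setIntegral_const, smul_eq_mul, mul_one, Ioi_inter_Iio, measureReal_def, Real.volume_Ioo,
    ENNReal.toReal_ofReal']
  exact max_le (by linarith) hρ

/-- `y² · y⁻⁴ = y⁻²` on `(r₀, ∞)`, `r₀ > 0`, in `rpow` form. -/
theorem sq_mul_inv_pow_four_eq {r₀ : ℝ} (hr₀ : 0 < r₀) :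
    ∀ y ∈ Ioi r₀, y ^ 2 * (y ^ 4)⁻¹ = y ^ (-2 : ℝ) := by
  intro y hy
  have hy0 : 0 < y := hr₀.trans hy
  have hy0' : y ≠ 0 := hy0.ne'
  rw [Real.rpow_neg hy0.le, Real.rpow_two]
  field_simp

/-- `1_{r₀ ≤ ‖η‖} ‖η‖⁻⁴` is integrable on `ℝ³` for `r₀ > 0` (polar coordinates,
`integrable_fun_norm_addHaar`: the radial integrand `y² · y⁻⁴ = y⁻²` is integrable on `[r₀, ∞)`). -/
theorem integrable_tail_inv_norm_four {r₀ : ℝ} (hr₀ : 0 < r₀) :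
    Integrable fun η : EuclideanSpace ℝ (Fin 3) =>
      {η : EuclideanSpace ℝ (Fin 3) | r₀ ≤ ‖η‖}.indicator (fun η => (‖η‖ ^ 4)⁻¹) η := by
  set f : ℝ → ℝ := (Ici r₀).indicator fun y => (y ^ 4)⁻¹ with hf
  have hfun : (fun η : EuclideanSpace ℝ (Fin 3) =>
      {η : EuclideanSpace ℝ (Fin 3) | r₀ ≤ ‖η‖}.indicator (fun η => (‖η‖ ^ 4)⁻¹) η) =
      fun η => f ‖η‖ := by
    funext η
    simp only [hf, indicator, mem_setOf_eq, mem_Ici]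
  rw [hfun]
  have h := integrable_fun_norm_addHaar (volume : Measure (EuclideanSpace ℝ (Fin 3))) (f := f)
  rw [finrank_euclideanSpace_fin_three] at h
  refine h.2 ?_
  -- the radial integrand is `1_{[r₀,∞)} y² y⁻⁴` on `(0, ∞)`
  have hpt : ∀ y ∈ Ioi (0 : ℝ),
      y ^ (3 - 1) • f y = (Ici r₀).indicator (fun y => y ^ 2 * (y ^ 4)⁻¹) y := by
    intro y _
    simp only [hf, indicator, mem_Ici, smul_eq_mul]
    split_ifs <;> simp
  refine (integrableOn_congr_fun hpt measurableSet_Ioi).2 ?_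
  have hg : IntegrableOn (fun y : ℝ => y ^ (-2 : ℝ)) (Ioi r₀) :=
    integrableOn_Ioi_rpow_of_lt (by norm_num) hr₀
  have hIoi : IntegrableOn (fun y : ℝ => y ^ 2 * (y ^ 4)⁻¹) (Ioi r₀) :=
    hg.congr_fun (fun y hy => (sq_mul_inv_pow_four_eq hr₀ y hy).symm) measurableSet_Ioi
  have hIci : IntegrableOn (fun y : ℝ => y ^ 2 * (y ^ 4)⁻¹) (Ici r₀) :=
    (integrableOn_Ici_iff_integrableOn_Ioi (by finiteness)).2 hIoi
  exact (hIci.integrable_indicator measurableSet_Ici).integrableOn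

/-- **The tail integral of `‖η‖⁻⁴`**: `∫ 1_{r₀ ≤ ‖η‖} ‖η‖⁻⁴ dη ≤ 3|B₁| r₀⁻¹` for `r₀ > 0` (polar
coordinates and `∫_{r₀}^∞ y⁻² dy = r₀⁻¹`; in fact equality). -/
theorem integral_tail_inv_norm_four_le {r₀ : ℝ} (hr₀ : 0 < r₀) :
    ∫ η : EuclideanSpace ℝ (Fin 3),
        {η : EuclideanSpace ℝ (Fin 3) | r₀ ≤ ‖η‖}.indicator (fun η => (‖η‖ ^ 4)⁻¹) η ≤
      3 * (volume (ball (0 : EuclideanSpace ℝ (Fin 3)) 1)).toReal * r₀⁻¹ := by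
  set f : ℝ → ℝ := (Ici r₀).indicator fun y => (y ^ 4)⁻¹ with hf
  have hfun : (fun η : EuclideanSpace ℝ (Fin 3) =>
      {η : EuclideanSpace ℝ (Fin 3) | r₀ ≤ ‖η‖}.indicator (fun η => (‖η‖ ^ 4)⁻¹) η) =
      fun η => f ‖η‖ := by
    funext η
    simp only [hf, indicator, mem_setOf_eq, mem_Ici]
  rw [hfun, integral_fun_norm_three f]
  have hvol : 0 ≤ 3 * (volume (ball (0 : EuclideanSpace ℝ (Fin 3)) 1)).toReal := by positivity
  refine mul_le_mul_of_nonneg_left ?_ hvol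
  have hpt : ∀ y ∈ Ioi (0 : ℝ), y ^ 2 * f y =
      (Ici r₀).indicator (fun y => y ^ 2 * (y ^ 4)⁻¹) y := by
    intro y _
    simp only [hf, indicator, mem_Ici]
    split_ifs <;> simp
  have hset : Ioi (0 : ℝ) ∩ Ici r₀ = Ici r₀ := by
    ext y
    simp only [mem_inter_iff, mem_Ioi, mem_Ici]
    exact ⟨fun h => h.2, fun h => ⟨hr₀.trans_le h, h⟩⟩
  rw [setIntegral_congr_fun measurableSet_Ioi hpt, setIntegral_indicator measurableSet_Ici, hset,
    setIntegral_congr_set (Ioi_ae_eq_Ici (α := ℝ) (μ := volume)).symm,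
    setIntegral_congr_fun measurableSet_Ioi (sq_mul_inv_pow_four_eq hr₀),
    integral_Ioi_rpow_of_lt (by norm_num) hr₀]
  have : (-2 : ℝ) + 1 = -1 := by norm_num
  rw [this, Real.rpow_neg_one]
  exact le_of_eq (by ring)

/-! ### The convolution and the nonlinearity under a critical envelope -/

/-- **The convolution under a critical envelope.** If `v : ℝ³ → ℂ³` satisfies `‖η‖² ‖v(η)‖ ≤ M`
everywhere, then at every frequency `ξ ≠ 0` and for all components,
`‖(v_j ⋆ v_k)(ξ)‖ ≤ 24 M² · 3|B₁| · ‖ξ‖⁻¹` — the scale-critical kernel bound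
`∫ ‖η‖⁻² ‖ξ-η‖⁻² dη ≲ ‖ξ‖⁻¹`: symmetrise over `‖ξ‖ ≤ 2‖η‖ ∨ ‖ξ‖ ≤ 2‖ξ-η‖`; on `‖ξ‖ ≤ 2‖η‖` the
factor at `η` carries `4M‖ξ‖⁻²` against the ball integral of `‖ζ‖⁻²`, `ζ = ξ - η`, `‖ζ‖ < ‖ξ‖`,
while for `‖ζ‖ ≥ ‖ξ‖` one has `‖η‖ ≤ 2‖ζ‖` and the product is `≤ 4M² ‖η‖⁻⁴` on `‖η‖ ≥ ‖ξ‖/2`. The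
pointwise bounds hold off the null set `{0, ξ}`. -/
theorem norm_fconv_le_of_envelope {v : EuclideanSpace ℝ (Fin 3) → Fin 3 → ℂ} {M : ℝ}
    {ξ : EuclideanSpace ℝ (Fin 3)} (hM0 : 0 ≤ M) (hM : ∀ η, ‖η‖ ^ 2 * ‖v η‖ ≤ M) (hξ : ξ ≠ 0)
    (j k : Fin 3) :
    ‖fconv (v · j) (v · k) ξ‖ ≤
      24 * M ^ 2 * (3 * (volume (ball (0 : EuclideanSpace ℝ (Fin 3)) 1)).toReal) * ‖ξ‖⁻¹ := by
  have hξ0 : 0 < ‖ξ‖ := norm_pos_iff.2 hξ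
  have hξne : ‖ξ‖ ≠ 0 := hξ0.ne'
  set CE : ℝ := 3 * (volume (ball (0 : EuclideanSpace ℝ (Fin 3)) 1)).toReal with hCE
  -- the comparison set of the tail piece
  set S : Set (EuclideanSpace ℝ (Fin 3)) := {η | ‖ξ‖ / 2 ≤ ‖η‖} with hS
  -- the two pieces of the majorant
  set C₂ : ℝ := 4 * M ^ 2 * (‖ξ‖ ^ 2)⁻¹ with hC₂
  set C₃ : ℝ := 4 * M ^ 2 with hC₃
  have hC₂0 : 0 ≤ C₂ := by positivity
  have hC₃0 : 0 ≤ C₃ := by positivity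
  set q : EuclideanSpace ℝ (Fin 3) → ℝ :=
    (ball (0 : EuclideanSpace ℝ (Fin 3)) ‖ξ‖).indicator fun ζ => (‖ζ‖ ^ 2)⁻¹ with hq
  set w : EuclideanSpace ℝ (Fin 3) → ℝ := S.indicator fun η => (‖η‖ ^ 4)⁻¹ with hw
  set b : EuclideanSpace ℝ (Fin 3) → ℝ := fun η => C₂ * q (ξ - η) + C₃ * w η with hb
  have hq0 : ∀ ζ, 0 ≤ q ζ := fun ζ => by
    simp only [hq]; exact Set.indicator_nonneg (fun _ _ => by positivity) _
  have hw0 : ∀ η, 0 ≤ w η := fun η => by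
    simp only [hw]; exact Set.indicator_nonneg (fun _ _ => by positivity) _
  have hb0 : ∀ η, 0 ≤ b η := fun η => by
    simp only [hb]
    have := hq0 (ξ - η); have := hw0 η
    positivity
  -- the envelope as a pointwise bound off the origin
  have hv : ∀ η : EuclideanSpace ℝ (Fin 3), η ≠ 0 → ‖v η‖ ≤ M * (‖η‖ ^ 2)⁻¹ := fun η hη => by
    have hη0 : 0 < ‖η‖ := norm_pos_iff.2 hη
    rw [← div_eq_mul_inv, le_div_iff₀ (by positivity), mul_comm]
    exact hM η
  -- halving a norm costs a factor `4` on the inverse square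
  have hinv : ∀ {a r : ℝ}, 0 < a → a ≤ 2 * r → (r ^ 2)⁻¹ ≤ 4 * (a ^ 2)⁻¹ := by
    intro a r ha har
    have h1 : (a / 2) ^ 2 ≤ r ^ 2 := pow_le_pow_left₀ (by positivity) (by linarith) 2
    calc (r ^ 2)⁻¹ ≤ ((a / 2) ^ 2)⁻¹ := inv_anti₀ (by positivity) h1
      _ = 4 * (a ^ 2)⁻¹ := by rw [div_pow, inv_div, div_eq_mul_inv]; norm_num
  -- the key pointwise bound on the region `‖ξ‖ ≤ 2‖η‖`, `η ≠ ξ`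
  have hkey : ∀ η, η ≠ ξ → ‖ξ‖ ≤ 2 * ‖η‖ → ‖v η‖ * ‖v (ξ - η)‖ ≤ b η := by
    intro η hηξ hη
    have hη0 : 0 < ‖η‖ := by linarith
    have hvη : ‖v η‖ ≤ M * (‖η‖ ^ 2)⁻¹ := hv η (norm_pos_iff.1 hη0)
    have hζne : ξ - η ≠ 0 := sub_ne_zero.2 (Ne.symm hηξ)
    have hvζ : ‖v (ξ - η)‖ ≤ M * (‖ξ - η‖ ^ 2)⁻¹ := hv _ hζne
    rcases lt_or_ge ‖ξ - η‖ ‖ξ‖ with h1 | h1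
    · -- `‖ξ - η‖ < ‖ξ‖`: the ball piece, with `‖v η‖ ≤ 4M‖ξ‖⁻²`
      have hvη' : ‖v η‖ ≤ 4 * M * (‖ξ‖ ^ 2)⁻¹ :=
        calc ‖v η‖ ≤ M * (‖η‖ ^ 2)⁻¹ := hvη
          _ ≤ M * (4 * (‖ξ‖ ^ 2)⁻¹) := mul_le_mul_of_nonneg_left (hinv hξ0 hη) hM0
          _ = 4 * M * (‖ξ‖ ^ 2)⁻¹ := by ring
      have hqζ : q (ξ - η) = (‖ξ - η‖ ^ 2)⁻¹ := by
        simp only [hq, indicator_of_mem (mem_ball_zero_iff.2 h1)]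
      calc ‖v η‖ * ‖v (ξ - η)‖ ≤ (4 * M * (‖ξ‖ ^ 2)⁻¹) * (M * (‖ξ - η‖ ^ 2)⁻¹) :=
            mul_le_mul hvη' hvζ (norm_nonneg _) (by positivity)
        _ = C₂ * q (ξ - η) := by rw [hqζ, hC₂]; ring
        _ ≤ b η := le_add_of_nonneg_right (mul_nonneg hC₃0 (hw0 η))
    · -- `‖ξ‖ ≤ ‖ξ - η‖`: then `‖η‖ ≤ 2‖ξ - η‖`, the tail piece on `‖η‖ ≥ ‖ξ‖/2`
      have hηS : η ∈ S := by
        simp only [hS, mem_setOf_eq]; linarith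
      have hη2 : ‖η‖ ≤ 2 * ‖ξ - η‖ := by
        have := norm_le_norm_add_norm_sub ξ η
        linarith
      have hvζ' : ‖v (ξ - η)‖ ≤ M * (4 * (‖η‖ ^ 2)⁻¹) :=
        hvζ.trans (mul_le_mul_of_nonneg_left (hinv hη0 hη2) hM0)
      have hwη : w η = (‖η‖ ^ 4)⁻¹ := by simp only [hw, indicator_of_mem hηS]
      have h4 : (‖η‖ ^ 4)⁻¹ = (‖η‖ ^ 2)⁻¹ * (‖η‖ ^ 2)⁻¹ := by
        rw [← mul_inv]; congr 1; ring
      calc ‖v η‖ * ‖v (ξ - η)‖ ≤ (M * (‖η‖ ^ 2)⁻¹) * (M * (4 * (‖η‖ ^ 2)⁻¹)) :=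
            mul_le_mul hvη hvζ' (norm_nonneg _) (by positivity)
        _ = C₃ * w η := by rw [hwη, h4, hC₃]; ring
        _ ≤ b η := le_add_of_nonneg_left (mul_nonneg hC₂0 (hq0 _))
  -- the symmetrised bound, off the null set `{0, ξ}`
  have hpt : ∀ η, η ≠ 0 → η ≠ ξ → ‖v η j * v (ξ - η) k‖ ≤ b η + b (ξ - η) := by
    intro η hη0 hηξ
    rw [norm_mul]
    have hjk : ‖v η j‖ * ‖v (ξ - η) k‖ ≤ ‖v η‖ * ‖v (ξ - η)‖ :=
      mul_le_mul (norm_le_pi_norm (v η) j) (norm_le_pi_norm (v (ξ - η)) k) (norm_nonneg _)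
        (norm_nonneg _)
    refine hjk.trans ?_
    rcases norm_le_two_mul_or ξ η with h1 | h1
    · linarith [hkey η hηξ h1, hb0 (ξ - η)]
    · have hne : ξ - η ≠ ξ := fun h => hη0 (by simpa using h)
      have h2 := hkey (ξ - η) hne h1
      rw [sub_sub_cancel, mul_comm] at h2
      linarith [hb0 η]
  have hae : ∀ᵐ η ∂(volume : Measure (EuclideanSpace ℝ (Fin 3))),
      ‖v η j * v (ξ - η) k‖ ≤ b η + b (ξ - η) := by
    filter_upwards [Measure.ae_ne volume (0 : EuclideanSpace ℝ (Fin 3)),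
      Measure.ae_ne volume ξ] with η h0 h1
    exact hpt η h0 h1
  -- integrability of the majorant
  have hqInt : Integrable q :=
    (integrableOn_inv_norm_sq_ball ‖ξ‖).integrable_indicator measurableSet_ball
  have hwInt : Integrable w := integrable_tail_inv_norm_four (by positivity : 0 < ‖ξ‖ / 2)
  have hqInt' : Integrable fun η => C₂ * q (ξ - η) := (hqInt.comp_sub_left ξ).const_mul C₂
  have hwInt' : Integrable fun η => C₃ * w η := hwInt.const_mul C₃
  have hbInt : Integrable b := by
    simp only [hb]
    exact hqInt'.add hwInt'
  have hbInt' : Integrable fun η => b (ξ - η) := hbInt.comp_sub_left ξ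
  -- the integral of the majorant
  have hIb : ∫ η, b η ≤ C₂ * (CE * ‖ξ‖) + C₃ * (CE * (‖ξ‖ / 2)⁻¹) := by
    have e : ∫ η, b η = C₂ * (∫ η, q (ξ - η)) + C₃ * ∫ η, w η := by
      simp only [hb]
      rw [integral_add hqInt' hwInt', integral_const_mul, integral_const_mul]
    rw [e, integral_sub_left_eq_self q volume ξ]
    have hI2 : ∫ ζ, q ζ ≤ CE * ‖ξ‖ := integral_ball_inv_norm_sq_le hξ0.le
    have hI3 : ∫ η, w η ≤ CE * (‖ξ‖ / 2)⁻¹ := integral_tail_inv_norm_four_le (by positivity)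
    gcongr
  have hIsum : ∫ η, (b η + b (ξ - η)) = 2 * ∫ η, b η := by
    rw [integral_add hbInt hbInt', integral_sub_left_eq_self b volume ξ]; ring
  calc ‖fconv (v · j) (v · k) ξ‖ = ‖∫ η, v η j * v (ξ - η) k‖ := by rw [fconv_apply]
    _ ≤ ∫ η, ‖v η j * v (ξ - η) k‖ := norm_integral_le_integral_norm _
    _ ≤ ∫ η, (b η + b (ξ - η)) :=
        integral_mono_of_nonneg (Eventually.of_forall fun η => norm_nonneg _) (hbInt.add hbInt')
          hae
    _ = 2 * ∫ η, b η := hIsum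
    _ ≤ 2 * (C₂ * (CE * ‖ξ‖) + C₃ * (CE * (‖ξ‖ / 2)⁻¹)) := by linarith [hIb]
    _ = 24 * M ^ 2 * CE * ‖ξ‖⁻¹ := by
        rw [hC₂, hC₃]
        field_simp
        ring

/-! ### The registered helper: the nonlinearity under a critical envelope -/

/-- **The nonlinearity under a critical envelope** (helper `envelopeBound_smallDataKernel` of the
support sub-goal `envelopeBound_smallData`): if `‖η‖² ‖v(η)‖ ≤ M` for all `η`, then
`‖N(v,v)(ξ)‖ ≤ 864π · 3|B₁| · M²` at every frequency (`TightEnvelope.norm_nonlin_le_of_fconv_le`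
with `X = 24 M² · 3|B₁| ‖ξ‖⁻¹` from `norm_fconv_le_of_envelope` for `ξ ≠ 0`; `N(v,v)(0) = 0`). -/
theorem envelopeBound_smallDataKernel :
    ∀ (v : EuclideanSpace ℝ (Fin 3) → Fin 3 → ℂ) (M : ℝ), 0 ≤ M →
      (∀ η : EuclideanSpace ℝ (Fin 3), ‖η‖ ^ 2 * ‖v η‖ ≤ M) →
      ∀ ξ : EuclideanSpace ℝ (Fin 3),
        ‖Literature.Analysis.FluidPDE.FourierNS.nonlin v v ξ‖ ≤
          864 * Real.pi * (3 * (MeasureTheory.volume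
            (Metric.ball (0 : EuclideanSpace ℝ (Fin 3)) 1)).toReal) * M ^ 2 := by
  intro v M hM0 hM ξ
  by_cases hξ : ξ = 0
  · rw [hξ, nonlin_zero_freq, norm_zero]; positivity
  have hξ0 : 0 < ‖ξ‖ := norm_pos_iff.2 hξ
  have hX0 : 0 ≤ 24 * M ^ 2 * (3 * (volume (ball (0 : EuclideanSpace ℝ (Fin 3)) 1)).toReal) *
      ‖ξ‖⁻¹ := by positivity
  calc ‖nonlin v v ξ‖ ≤ 36 * π * ‖ξ‖ *
        (24 * M ^ 2 * (3 * (volume (ball (0 : EuclideanSpace ℝ (Fin 3)) 1)).toReal) * ‖ξ‖⁻¹) :=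
        norm_nonlin_le_of_fconv_le hX0 fun j k => norm_fconv_le_of_envelope hM0 hM hξ j k
    _ = 864 * π * (3 * (volume (ball (0 : EuclideanSpace ℝ (Fin 3)) 1)).toReal) * M ^ 2 := by
        field_simp
        ring

end Summit.NavierStokesRegularity.NavierStokesRegularity.Theorems.EnvelopeBound.Registered

end
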